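import Literature.Computability.Cryptography.PerfectRandomizedEncoding
import Literature.Computability.Complexity.DegreeThreeEncodingEntropy
import HarnessLib

/-!
# Perfect extensions of sparse polynomial maps over `F₂` are perfect randomized encodings

Bridge between the valuation-level notion `RandPoly.PerfExt n (n + m) O g` of the randomizing-
polynomials series (`Literature/Computability/Complexity/RandomizingPolynomialsPerfect.lean`: a
block `O` of sparse output polynomials with fresh variables `[n, n + m)` is injective on the fresh
variables, decodes the target `g`, and has a range depending only on `g`) and the combinatorial
notion `IsPerfectRandomizedEncoding` of Dvir–Gutfreund–Rothblum–Vadhan / Applebaum–Ishai–Kushilevitz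
(`PerfectRandomizedEncoding.lean`):

* `RandPoly.PerfExt.isPerfectRandomizedEncoding` — reading the prefix `x ∈ F₂ⁿ` as the input and
  the fresh block `r ∈ F₂^m` as the randomness, `(x, r) ↦ O(x, r)` is a perfect randomized encoding
  of `x ↦ g x` with blowup `2^m` (AIK's stretch-preserving case, via `of_injective`);
  `isPerfectRandomizedEncoding_toFinMap` — the same for the `Fin (n+m)`-indexed map `toFinMap`.
* `isPerfectRandomizedEncoding_reduceInst` — **the degree-3 encoding of the tree is a perfect
  randomized encoding**: for a `PEA` instance `I = (n, P, k)`, the reduced map `P'` of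
  `RandPoly.reduceInst I` (DGRV Thm 4.5 as formalized in `DegreeThreeEncodingEntropy.lean`, degree
  `≤ 3`) satisfies `IsPerfectRandomizedEncoding P.eval (fun x r => P'.eval (Fin.append x r)) (2^m)`,
  `m = freshOf I` [DGRV 2010, Thm 4.5; IK 2002, §3].
* `PolyMapF2.entropy_eq_of_isPerfectRandomizedEncoding` — the form consumed by entropy-approximation
  reductions: if `Q : PolyMapF2 (n + m)` read on `F₂ⁿ × F₂^m` is a perfect randomized encoding of
  ANY `g : F₂ⁿ → β` with blowup `b`, then `H(Q(U_{n+m})) = H(g(U_n)) + log₂ b`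
  (`… + k` for `b = 2^k`, `entropy_eq_add_of_isPerfectRandomizedEncoding`) [DGRV 2010, Claim 4.4 /
  proof of Thm 4.6; Allender–Gray–Mutreja–Tirumala–Wang 2025, Lemma 10].

NOT here: perfect encodings of general branching programs (AIK Lemma 4.15) — see the module
docstring of `PerfectRandomizedEncoding.lean`.

## References

* Z. Dvir, D. Gutfreund, G. N. Rothblum, S. Vadhan, ECCC TR10-160 (2010), §4.1 (Def. 4.1,
  Claims 4.2–4.4), Thm 4.5–4.6.  bib `DvirGutfreundRothblumVadhan2010`.
* B. Applebaum, Y. Ishai, E. Kushilevitz, SIAM J. Comput. 36 (2006), §4.1 (p. 9), Lemma 4.12.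
* Y. Ishai, E. Kushilevitz, ICALP 2002, §3.
-/

namespace Literature.Computability.Cryptography

open Finset Literature.InformationTheory.Entropy Literature.Computability.Complexity
open Literature.Computability.Complexity.RandPoly

/-! ### Valuations of appended vectors -/

/-- The valuation of `Fin.append x r` agrees below `n` with the valuation of `x`. [folklore] -/
theorem agreeBelow_valOf_append_valOf {n m : ℕ} (x : Fin n → ZMod 2) (r : Fin m → ZMod 2) :
    AgreeBelow n (valOf (Fin.append x r)) (valOf x) := fun i hi => by
  rw [valOf_append_of_lt x r hi, valOf, dif_pos hi]

/-! ### Perfect extensions are perfect randomized encodings with blowup `2^m` -/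

/-- **A perfect extension is a perfect randomized encoding with blowup `2^m`**: for a block `O`
with variables below `n + m` perfectly extending a target `g` that reads only variables below `n`,
the map `(x, r) ↦ O(x ‖ r)` on `F₂ⁿ × F₂^m` is a perfect randomized encoding of `x ↦ g x` in the
sense of DGRV Def. 4.1, with blowup `2^m` (injective in `r`: AIK's stretch-preserving case).
[cite: ApplebaumIshaiKushilevitz2006, §4.1 p. 9] -/
theorem _root_.Literature.Computability.Complexity.RandPoly.PerfExt.isPerfectRandomizedEncoding
    {β : Type} {n m : ℕ} {O : List (List (List ℕ))} {g : (ℕ → ZMod 2) → β}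
    (hPE : PerfExt n (n + m) O g) (hO : VarsIn (fun x => x < n + m) O)
    (hg : ∀ v w, AgreeBelow n v w → g v = g w) :
    IsPerfectRandomizedEncoding (fun x : Fin n → ZMod 2 => g (valOf x))
      (fun (x : Fin n → ZMod 2) (r : Fin m → ZMod 2) => evalM (valOf (Fin.append x r)) O) (2 ^ m) := by
  have hcard : Fintype.card (Fin m → ZMod 2) = 2 ^ m := by
    rw [Fintype.card_fun, ZMod.card, Fintype.card_fin]
  rw [← hcard]
  refine IsPerfectRandomizedEncoding.of_injective (fun x r r' hrr' => ?_)
    (fun x x' r r' h => ?_) (fun x x' hxx' r => ?_)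
  · -- unique randomness: same prefix and same outputs force the same fresh block
    have hag := hPE.inj _ _ (agreeBelow_valOf_append x r r') hrr'
    funext j
    have := hag (n + j.val) (by omega)
    rwa [valOf_append_add, valOf_append_add] at this
  · -- decoding
    have := hPE.dec _ _ h
    rwa [hg _ _ (agreeBelow_valOf_append_valOf x r), hg _ _ (agreeBelow_valOf_append_valOf x' r')] at this
  · -- the range depends only on the target
    have ht : g (valOf (Fin.append x r)) = g (valOf (Fin.append x' r)) := by
      rw [hg _ _ (agreeBelow_valOf_append_valOf x r), hg _ _ (agreeBelow_valOf_append_valOf x' r)]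
      exact hxx'
    obtain ⟨u, huw, hue⟩ := hPE.range _ _ ht
    refine ⟨fun j => u (n + j.val), ?_⟩
    show evalM (valOf (Fin.append x' fun j : Fin m => u (n + j.val))) O = evalM (valOf (Fin.append x r)) O
    rw [← hue]
    refine evalM_congr_of_varsIn hO fun i hi => ?_
    by_cases hin : i < n
    · rw [valOf_append_of_lt x' _ hin, ← valOf_append_of_lt x' r hin]
      exact (huw i hin).symm
    · obtain ⟨j, rfl⟩ : ∃ j, i = n + j := ⟨i - n, by omega⟩
      exact valOf_append_add x' (fun j : Fin m => u (n + j.val)) ⟨j, by omega⟩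

/-- The same for the `Fin (n + m)`-indexed presentation `toFinMap (n + m) O`. [cite: ApplebaumIshaiKushilevitz2006, §4.1 p. 9] -/
theorem isPerfectRandomizedEncoding_toFinMap {β : Type} {n m : ℕ} {O : List (List (List ℕ))}
    {g : (ℕ → ZMod 2) → β} (hPE : PerfExt n (n + m) O g) (hO : VarsIn (fun x => x < n + m) O)
    (hg : ∀ v w, AgreeBelow n v w → g v = g w) :
    IsPerfectRandomizedEncoding (fun x : Fin n → ZMod 2 => g (valOf x))
      (fun (x : Fin n → ZMod 2) (r : Fin m → ZMod 2) => (toFinMap (n + m) O hO).eval (Fin.append x r))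
      (2 ^ m) := by
  have heq : (fun (x : Fin n → ZMod 2) (r : Fin m → ZMod 2) => (toFinMap (n + m) O hO).eval (Fin.append x r))
      = fun x r => evalM (valOf (Fin.append x r)) O := by
    funext x r
    rw [eval_eq_evalM, natOf_toFinMap]
  rw [heq]
  exact hPE.isPerfectRandomizedEncoding hO hg

/-- **The tree's degree-3 encoding is a perfect randomized encoding** (DGRV Thm 4.5 for sparse
polynomial maps, in the vocabulary of Def. 4.1): for a `PEA` instance `I = (n, P, k)` with reduced
instance `(n + m, P', k + m)`, `m = freshOf I`, the map `(x, r) ↦ P'(x ‖ r)` is a perfect randomized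
encoding of `P.eval` with blowup `2^m` (and `deg P' ≤ 3`, `RandPoly.degLE_reduceInst`).
[cite: DvirGutfreundRothblumVadhan2010, Thm 4.5] -/
theorem isPerfectRandomizedEncoding_reduceInst (I : PEAInst) :
    IsPerfectRandomizedEncoding I.2.1.eval
      (fun (x : Fin I.1 → ZMod 2) (r : Fin (freshOf I) → ZMod 2) =>
        (reduceInst I).2.1.eval (Fin.append x r))
      (2 ^ freshOf I) := by
  have hPE := perfExt_encodeMap I.1 (natOf I.2.1) (varsIn_natOf I.2.1)
  have heq : (encodeMap I.1 (natOf I.2.1)).1 = I.1 + freshOf I := by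
    have := le_encodeMap_fst I.1 (natOf I.2.1)
    unfold freshOf
    omega
  rw [heq] at hPE
  have hg : ∀ v w : ℕ → ZMod 2, AgreeBelow I.1 v w → evalM v (natOf I.2.1) = evalM w (natOf I.2.1) :=
    fun v w hvw => evalM_congr_of_varsIn (varsIn_natOf I.2.1) fun x hx => hvw x hx
  refine (isPerfectRandomizedEncoding_toFinMap hPE (varsIn_encodeMap_natOf I) hg).of_fiber_iff
    fun x x' => ?_
  rw [eval_eq_evalM, eval_eq_evalM]

/-! ### The entropy identity for sparse polynomial maps -/

/-- **Entropy of a polynomial map that is a perfect randomized encoding**: if `Q : F₂^{n+m} → F₂^*`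
read on `F₂ⁿ × F₂^m` is a perfect randomized encoding of `g : F₂ⁿ → β` with blowup `b`, then
`H(Q(U_{n+m})) = H(g(U_n)) + log₂ b`. [cite: DvirGutfreundRothblumVadhan2010, Claim 4.4] -/
theorem _root_.Literature.Computability.Complexity.PolyMapF2.entropy_eq_of_isPerfectRandomizedEncoding
    {n m : ℕ} {β : Type*} [DecidableEq β] (Q : PolyMapF2 (n + m)) {g : (Fin n → ZMod 2) → β} {b : ℕ}
    (h : IsPerfectRandomizedEncoding g
      (fun (x : Fin n → ZMod 2) (r : Fin m → ZMod 2) => Q.eval (Fin.append x r)) b) :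
    Q.entropy = mapEntropy univ g + Real.logb 2 b := by
  unfold PolyMapF2.entropy
  rw [← Literature.InformationTheory.Entropy.mapEntropy_univ_comp_equiv (Fin.appendEquiv n m)]
  have heq : Q.eval ∘ Fin.appendEquiv n m =
      Function.uncurry fun (x : Fin n → ZMod 2) (r : Fin m → ZMod 2) => Q.eval (Fin.append x r) := by
    funext p
    obtain ⟨x, r⟩ := p
    rfl
  rw [heq]
  exact h.mapEntropy_uncurry_eq

/-- **… with blowup `2^k`: `H(Q(U_{n+m})) = H(g(U_n)) + k`** — "the entropy of the encoding exceeds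
the entropy of the encoded map by exactly the logarithm of the blowup" (for a stretch-preserving
encoding, `k = m` = the randomness length). [cite: DvirGutfreundRothblumVadhan2010, Thm 4.6 (proof)] -/
theorem _root_.Literature.Computability.Complexity.PolyMapF2.entropy_eq_add_of_isPerfectRandomizedEncoding
    {n m k : ℕ} {β : Type*} [DecidableEq β] (Q : PolyMapF2 (n + m)) {g : (Fin n → ZMod 2) → β}
    (h : IsPerfectRandomizedEncoding g
      (fun (x : Fin n → ZMod 2) (r : Fin m → ZMod 2) => Q.eval (Fin.append x r)) (2 ^ k)) :
    Q.entropy = mapEntropy univ g + k := by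
  rw [Q.entropy_eq_of_isPerfectRandomizedEncoding h, Nat.cast_pow, Nat.cast_ofNat, Real.logb_pow,
    Real.logb_self_eq_one (by norm_num), mul_one]

/-- Consistency with the series: the entropy identity `H(P') = H(P) + m` of the reduced instance
(`RandPoly.entropy_reduceInst`) is the case `g = P.eval`, `b = 2^m` of the abstract identity.
[cite: DvirGutfreundRothblumVadhan2010, Thm 4.5–4.6] -/
example (I : PEAInst) :
    PolyMapF2.entropy (reduceInst I).2.1 = PolyMapF2.entropy I.2.1 + freshOf I :=
  (reduceInst I).2.1.entropy_eq_add_of_isPerfectRandomizedEncoding (isPerfectRandomizedEncoding_reduceInst I)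

end Literature.Computability.Cryptography
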